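import Summits.QuantumFields.YangMills.Theorems.BalabanLadderIRTwistedSlabFlatClassification
import Summits.QuantumFields.YangMills.Theorems.BalabanLadderIRTwistedSlabClassicalRate
import Literature.MathematicalPhysics.QuantumLattice.IsolatingTwistIffGenerating
import HarnessLib

/-!
# Gauge orbits of the classical vacua of the twisted slab: quadruples mod conjugation, stabilisers, the `SU(N)` zero set

HELPER toward stub **T1** `TwistedSlabAnchor` (LINE `twisted-slab-continuity`, crux `IRcof` stmt-QuantumFields-26930, census row 43;
LEAD prover ym-ir-line-tsc-p1 g2; `--supports` the crux, `--as helper`).  File 4/4 of next-seat-plan item (1): the ORBIT STRUCTURE of the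
zero-action set classified in `…TwistedSlabFlatClassification`.
* §1 (any `G`, any box): a gauge map sends a ladder to a ladder iff it is CONSTANT and conjugates the quadruple
  (`gaugeAct_ladderConfig_eq_ladderConfig_iff`); so **gauge classes of classical vacua ↔ twist-eating quadruples modulo simultaneous
  conjugation** (`exists_gaugeAct_ladderConfig_eq_iff`, `gaugeAct_ladderConfig_eq_gaugeAct_ladderConfig_iff`) and **stabiliser of a ladder =
  constant maps into the centraliser of its quadruple** (`gaugeAct_ladderConfig_eq_self_iff`).
* §2 (slab tensor): `eats_slabTwist_iff`; `eater_slabTwist_central` (isolation ⇒ `Γ₂, Γ₃` central, `zE = 1`); ★★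
  `exists_gaugeAct_ladder_pair_of_twistedFlat_slab` — isolating `zM`, one reference pair `B A B⁻¹ A⁻¹ = zM`: every classical vacuum of the
  magnetically twisted slab is a gauge transform of a DECORATED ladder `(A, B, c₂, c₃)`, `c₂, c₃ ∈ Z(G)`; `ladder_pair_labels_unique`
  (centre labels are gauge invariants; residual freedom = centraliser of the pair); `gaugeAct_ladder_pair_eq_self_iff`.
* §3 (`SU(N)`, `z = ω^k·1`, `k` a unit; lit-4 p653142 ∕ p659359 ∕ p659597): ★★ the zero-action set of the `(z,1)` slab on ANY box is
  `⋃_{(i,j) ∈ (ℤ/N)²} 𝒢 • ladder(A, B, ω^i·1, ω^j·1)`, distinct labels ↔ distinct orbits, residual freedom `Z_N`, **each orbit ≅ 𝒢 ∕ Z_N**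
  (`exists_gaugeAct_ladder_pair_of_twistedFlat_slab_specialUnitary`, `ladder_pair_labels_unique_specialUnitary`,
  `gaugeAct_ladder_pair_eq_self_iff_specialUnitary`).
* §4: in the currency of `wilsonFinTorusTensorTwistedPartition`'s integrand — `twistedAction_gaugeAct`, `ladder_pair_twistedFlat`, ★★
  `twistedAction_eq_zero_iff_exists_gaugeAct_ladder_specialUnitary`: the twisted Wilson action of the magnetic slab (faithful unitary `ρ`)
  VANISHES EXACTLY on that union; the summands `z^{k′} ≠ 1` of `projSlabZ` have empty zero set (`no_twistedFlat_slab_specialUnitary`).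
This is the complete Morse–Bott critical set of the e₂-projected slab weight = input (K2) of the T1-box programme (T1-ANATOMY §5): a
Laplace–Morse–Bott asymptotic of `projSlabZ` (`β → ∞`) and a semiclassical (Helffer-class) bound for the projected transfer operator both
START from «`N²` isolated orbits `𝒢/Z_N`, transversally non-degenerate» (transverse non-degeneracy at tree level = lit-4's slab Hessian
gap, p660908).

HONEST FRAMING: lattice group algebra on one box; no estimate, nothing uniform in `β` or `L`; T1 proper (uniform exponential vacuum
dominance) untouched, 0∕1; nothing here bears on `IRcof`, `IR`, or the Yang–Mills mass gap (Clay: NOT proved); R4 = `BalabanLadder.UV`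
only.  References: 't Hooft, Nucl. Phys. B153 (1979) §3; van Baal, Commun. Math. Phys. 85 (1982) 529; González-Arroyo, hep-th/9807108
§4.2; García Pérez–González-Arroyo–Okawa, IJMPA 29 (2014) §2 («gauge-inequivalent zero-action solutions = inequivalent twist eaters»).
-/

set_option autoImplicit false

open Literature.MathematicalPhysics.QuantumFieldTheory

namespace Summit.QuantumFields.YangMills.Cruxes.IRcof.TwistedSlab

variable {G : Type*} [Group G]

open Fin.NatCast

/-- Conjugation fixes central elements. [folklore] -/
theorem conj_eq_of_mem_center {z : G} (hz : z ∈ Subgroup.center G) (h : G) : h * z * h⁻¹ = z := by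
  rw [Subgroup.mem_center_iff.mp hz h, mul_inv_cancel_right]

/-! ## §1 Gauge classes of ladders = simultaneous conjugacy classes of quadruples; stabilisers -/

section Orbits

variable {m₀ m₁ m₂ m₃ : ℕ}

/-- A site function invariant under every non-sheet shift is constant (every site is reached from `(1,1,1,1)` by such moves). [folklore] -/
theorem eq_base_of_shift_invariant {α : Type*} (f : FinTorusSite (m₀ + 1) (m₁ + 1) (m₂ + 1) (m₃ + 1) → α)
    (hf : ∀ (x : FinTorusSite (m₀ + 1) (m₁ + 1) (m₂ + 1) (m₃ + 1)) (ν : Fin 4), finTorusSiteCoord x ν ≠ 0 → f (x.shift ν) = f x)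
    (x : FinTorusSite (m₀ + 1) (m₁ + 1) (m₂ + 1) (m₃ + 1)) : f x = f (natSite m₀ m₁ m₂ m₃ 1 1 1 1) := by
  obtain ⟨a, b, c, d⟩ := x
  have hc := fun i j k l => coord_natSite_ne_zero (m₀ := m₀) (m₁ := m₁) (m₂ := m₂) (m₃ := m₃) i j k l
  have hs := fun i j k l => natSite_shift (m₀ := m₀) (m₁ := m₁) (m₂ := m₂) (m₃ := m₃) i j k l
  have line : ∀ (e : ℕ → FinTorusSite (m₀ + 1) (m₁ + 1) (m₂ + 1) (m₃ + 1)) (ν : Fin 4), (∀ t, (e t).shift ν = e (t + 1)) →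
      ∀ {M : ℕ}, (∀ t, 1 ≤ t → t ≤ M → finTorusSiteCoord (e t) ν ≠ 0) → ∀ {t : ℕ}, 1 ≤ t → t ≤ M + 1 → f (e t) = f (e 1) :=
    fun e ν he M hM t ht1 ht =>
      eq_of_forall_succ_eq (f := fun t => f (e t)) (fun t h1 h2 => by rw [← he t]; exact hf (e t) ν (hM t h1 h2)) t ht1 ht
  rw [← natSite_finRep a b c d]
  have h1 : f (natSite m₀ m₁ m₂ m₃ (finRep a) (finRep b) (finRep c) (finRep d)) = f (natSite m₀ m₁ m₂ m₃ 1 (finRep b) (finRep c) (finRep d)) :=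
    line (fun t => natSite m₀ m₁ m₂ m₃ t (finRep b) (finRep c) (finRep d)) 0 (fun t => (hs t _ _ _).1)
      (fun t h1 h2 => (hc t _ _ _).1 h1 h2) (one_le_finRep a) (finRep_le a)
  have h2 : f (natSite m₀ m₁ m₂ m₃ 1 (finRep b) (finRep c) (finRep d)) = f (natSite m₀ m₁ m₂ m₃ 1 1 (finRep c) (finRep d)) :=
    line (fun t => natSite m₀ m₁ m₂ m₃ 1 t (finRep c) (finRep d)) 1 (fun t => (hs _ t _ _).2.1)
      (fun t h1 h2 => (hc _ t _ _).2.1 h1 h2) (one_le_finRep b) (finRep_le b)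
  have h3 : f (natSite m₀ m₁ m₂ m₃ 1 1 (finRep c) (finRep d)) = f (natSite m₀ m₁ m₂ m₃ 1 1 1 (finRep d)) :=
    line (fun t => natSite m₀ m₁ m₂ m₃ 1 1 t (finRep d)) 2 (fun t => (hs _ _ t _).2.2.1)
      (fun t h1 h2 => (hc _ _ t _).2.2.1 h1 h2) (one_le_finRep c) (finRep_le c)
  have h4 : f (natSite m₀ m₁ m₂ m₃ 1 1 1 (finRep d)) = f (natSite m₀ m₁ m₂ m₃ 1 1 1 1) :=
    line (fun t => natSite m₀ m₁ m₂ m₃ 1 1 1 t) 3 (fun t => (hs _ _ _ t).2.2.2)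
      (fun t h1 h2 => (hc _ _ _ t).2.2.2 h1 h2) (one_le_finRep d) (finRep_le d)
  rw [h1, h2, h3, h4]

/-- ★ **A gauge transformation maps a ladder to a ladder iff it is CONSTANT, and then it conjugates the quadruple.** [folklore] -/
theorem gaugeAct_ladderConfig_eq_ladderConfig_iff (g : FinTorusSite (m₀ + 1) (m₁ + 1) (m₂ + 1) (m₃ + 1) → G) (Γ Γ' : Fin 4 → G) :
    gaugeAct g (ladderConfig Γ) = ladderConfig Γ' ↔ ∃ h : G, (g = fun _ => h) ∧ ∀ μ, Γ' μ = h * Γ μ * h⁻¹ := by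
  constructor
  · intro hg
    have hconst : ∀ (x : FinTorusSite (m₀ + 1) (m₁ + 1) (m₂ + 1) (m₃ + 1)) (ν : Fin 4), finTorusSiteCoord x ν ≠ 0 →
        g (x.shift ν) = g x := by
      intro x ν hx
      have h := congrFun hg (x, ν)
      rw [gaugeAct_apply, ladderConfig_apply, ladderConfig_apply, if_neg hx, if_neg hx, mul_one, mul_inv_eq_one] at h
      exact h.symm
    have hg' : g = fun _ => g (natSite m₀ m₁ m₂ m₃ 1 1 1 1) := funext fun x => eq_base_of_shift_invariant g hconst x
    refine ⟨g (natSite m₀ m₁ m₂ m₃ 1 1 1 1), hg', fun μ => ?_⟩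
    have h0 : finTorusSiteCoord (natSite m₀ m₁ m₂ m₃ 0 0 0 0) μ = 0 := by
      rw [finTorusSiteCoord_natSite]; fin_cases μ <;> simp
    have e := congrFun hg (natSite m₀ m₁ m₂ m₃ 0 0 0 0, μ)
    rw [hg'] at e
    simp only [gaugeAct_apply, ladderConfig_apply, if_pos h0] at e
    exact e.symm
  · rintro ⟨h, rfl, hΓ⟩
    rw [gaugeAct_const_ladderConfig]
    exact congrArg ladderConfig (funext fun μ => (hΓ μ).symm)

/-- **Gauge classes of ladders ↔ quadruples modulo simultaneous conjugation.** [folklore] -/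
theorem exists_gaugeAct_ladderConfig_eq_iff (Γ Γ' : Fin 4 → G) :
    (∃ g : FinTorusSite (m₀ + 1) (m₁ + 1) (m₂ + 1) (m₃ + 1) → G, gaugeAct g (ladderConfig Γ) = ladderConfig Γ') ↔
      ∃ h : G, ∀ μ, Γ' μ = h * Γ μ * h⁻¹ := by
  constructor
  · rintro ⟨g, hg⟩
    obtain ⟨h, -, hΓ⟩ := (gaugeAct_ladderConfig_eq_ladderConfig_iff g Γ Γ').mp hg
    exact ⟨h, hΓ⟩
  · rintro ⟨h, hΓ⟩
    exact ⟨fun _ => h, (gaugeAct_ladderConfig_eq_ladderConfig_iff _ Γ Γ').mpr ⟨h, rfl, hΓ⟩⟩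

/-- Two gauge transforms of ladders coincide iff the gauge maps differ by a constant right factor conjugating the quadruples. [folklore] -/
theorem gaugeAct_ladderConfig_eq_gaugeAct_ladderConfig_iff (g g' : FinTorusSite (m₀ + 1) (m₁ + 1) (m₂ + 1) (m₃ + 1) → G)
    (Γ Γ' : Fin 4 → G) :
    gaugeAct g (ladderConfig Γ) = gaugeAct g' (ladderConfig Γ') ↔
      ∃ h : G, (g = fun x => g' x * h) ∧ ∀ μ, Γ' μ = h * Γ μ * h⁻¹ := by
  have key : gaugeAct g (ladderConfig Γ) = gaugeAct g' (ladderConfig Γ') ↔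
      gaugeAct (g'⁻¹ * g) (ladderConfig Γ) = ladderConfig (n₀ := m₀ + 1) (n₁ := m₁ + 1) (n₂ := m₂ + 1) (n₃ := m₃ + 1) Γ' := by
    constructor
    · intro h; rw [gaugeAct_mul, h, gaugeAct_inv_gaugeAct]
    · intro h
      have h' := congrArg (gaugeAct g') h
      rwa [← gaugeAct_mul, mul_inv_cancel_left] at h'
  rw [key, gaugeAct_ladderConfig_eq_ladderConfig_iff]
  refine exists_congr fun h => and_congr_left fun _ => ?_
  constructor
  · intro e; funext x; have ex := congrFun e x
    simp only [Pi.mul_apply, Pi.inv_apply] at ex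
    rw [← ex, mul_inv_cancel_left]
  · intro e; funext x
    simp only [Pi.mul_apply, Pi.inv_apply, e, inv_mul_cancel_left]

/-- **Stabiliser of a ladder**: a gauge transformation fixes `ladderConfig Γ` iff it is a CONSTANT commuting with every `Γ_μ`. [folklore] -/
theorem gaugeAct_ladderConfig_eq_self_iff (g : FinTorusSite (m₀ + 1) (m₁ + 1) (m₂ + 1) (m₃ + 1) → G) (Γ : Fin 4 → G) :
    gaugeAct g (ladderConfig Γ) = ladderConfig Γ ↔ ∃ h : G, (g = fun _ => h) ∧ ∀ μ, h * Γ μ * h⁻¹ = Γ μ := by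
  rw [gaugeAct_ladderConfig_eq_ladderConfig_iff]
  exact exists_congr fun h => and_congr_right fun _ => forall_congr' fun μ => eq_comm

end Orbits

/-! ## §2 The slab twist: eating quadruples, and the magnetically twisted slab with an ISOLATING twist -/

section Slab

variable {m₀ m₁ m₂ m₃ : ℕ}

/-- **Eating the slab tensor**, plane by plane: `(Γ₀, Γ₁)` eats `zM`, `(Γ₂, Γ₃)` eats `zE`, the four mixed pairs commute. [folklore] -/
theorem eats_slabTwist_iff (zM zE : G) (Γ : Fin 4 → G) :
    (∀ μ ν : Fin 4, μ < ν → slabTwist zM zE μ ν * (Γ μ * Γ ν * (Γ μ)⁻¹ * (Γ ν)⁻¹) = 1) ↔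
      zM * (Γ 0 * Γ 1 * (Γ 0)⁻¹ * (Γ 1)⁻¹) = 1 ∧ zE * (Γ 2 * Γ 3 * (Γ 2)⁻¹ * (Γ 3)⁻¹) = 1 ∧
        Γ 0 * Γ 2 * (Γ 0)⁻¹ * (Γ 2)⁻¹ = 1 ∧ Γ 0 * Γ 3 * (Γ 0)⁻¹ * (Γ 3)⁻¹ = 1 ∧
        Γ 1 * Γ 2 * (Γ 1)⁻¹ * (Γ 2)⁻¹ = 1 ∧ Γ 1 * Γ 3 * (Γ 1)⁻¹ * (Γ 3)⁻¹ = 1 := by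
  constructor
  · intro h
    refine ⟨by simpa [slabTwist] using h 0 1 (by decide), by simpa [slabTwist] using h 2 3 (by decide),
      by simpa [slabTwist] using h 0 2 (by decide), by simpa [slabTwist] using h 0 3 (by decide),
      by simpa [slabTwist] using h 1 2 (by decide), by simpa [slabTwist] using h 1 3 (by decide)⟩
  · rintro ⟨h01, h23, h02, h03, h12, h13⟩ μ ν hμν
    fin_cases μ <;> fin_cases ν <;> simp (config := { decide := true }) at hμν <;> simpa [slabTwist]

/-- **Isolation pins `Γ₂, Γ₃` to the centre**: if every element commuting with a pair of commutator `zM` is central, an eating quadruple of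
`slabTwist zM zE` has `Γ₂, Γ₃ ∈ Z(G)` and `zE = 1` (`no_twistedFlat_slab` at the level of quadruples). [folklore] -/
theorem eater_slabTwist_central {zM zE : G}
    (hcent : ∀ A B M : G, B * A * B⁻¹ * A⁻¹ = zM → M * A * M⁻¹ * A⁻¹ = 1 → M * B * M⁻¹ * B⁻¹ = 1 → M ∈ Subgroup.center G)
    {Γ : Fin 4 → G} (h : ∀ μ ν : Fin 4, μ < ν → slabTwist zM zE μ ν * (Γ μ * Γ ν * (Γ μ)⁻¹ * (Γ ν)⁻¹) = 1) :
    Γ 2 ∈ Subgroup.center G ∧ Γ 3 ∈ Subgroup.center G ∧ zE = 1 := by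
  obtain ⟨h01, h23, h02, h03, h12, h13⟩ := (eats_slabTwist_iff zM zE Γ).mp h
  have hpair : Γ 1 * Γ 0 * (Γ 1)⁻¹ * (Γ 0)⁻¹ = zM := by
    have e : zM = (Γ 0 * Γ 1 * (Γ 0)⁻¹ * (Γ 1)⁻¹)⁻¹ := eq_inv_of_mul_eq_one_left h01
    rw [e]; group
  have hinv : ∀ {a b : G}, a * b * a⁻¹ * b⁻¹ = 1 → b * a * b⁻¹ * a⁻¹ = 1 := fun {a b} e => by
    have e' := congrArg (·⁻¹) e
    simpa [mul_inv_rev, mul_assoc] using e'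
  have h2 : Γ 2 ∈ Subgroup.center G := hcent (Γ 0) (Γ 1) (Γ 2) hpair (hinv h02) (hinv h12)
  have h3 : Γ 3 ∈ Subgroup.center G := hcent (Γ 0) (Γ 1) (Γ 3) hpair (hinv h03) (hinv h13)
  refine ⟨h2, h3, ?_⟩
  have hc : Γ 2 * Γ 3 * (Γ 2)⁻¹ * (Γ 3)⁻¹ = 1 := by
    rw [← Subgroup.mem_center_iff.mp h2 (Γ 3)]; group
  rw [hc, mul_one] at h23
  exact h23

/-- ★★ **CLASSICAL VACUA OF THE MAGNETICALLY TWISTED SLAB WITH AN ISOLATING TWIST.**  `zM ∈ Z(G)` isolating (pairs of commutator `zM`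
simultaneously conjugate; their simultaneous centraliser central), ONE reference pair `B A B⁻¹ A⁻¹ = zM`: every twisted-flat configuration of
`slabTwist zM 1` on any box is a gauge transform of the ladder `(A, B, c₂, c₃)` with CENTRAL `c₂, c₃` — the twist-eating vacuum decorated
by the two centre-valued Polyakov holonomies. [folklore] -/
theorem exists_gaugeAct_ladder_pair_of_twistedFlat_slab {zM : G} (hM : zM ∈ Subgroup.center G)
    (hconj : ∀ A B A' B' : G, B * A * B⁻¹ * A⁻¹ = zM → B' * A' * B'⁻¹ * A'⁻¹ = zM →
      ∃ h : G, A' = h * A * h⁻¹ ∧ B' = h * B * h⁻¹)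
    (hcent : ∀ A B M : G, B * A * B⁻¹ * A⁻¹ = zM → M * A * M⁻¹ * A⁻¹ = 1 → M * B * M⁻¹ * B⁻¹ = 1 → M ∈ Subgroup.center G)
    {A B : G} (hAB : B * A * B⁻¹ * A⁻¹ = zM)
    (U : FinTorusSite (m₀ + 1) (m₁ + 1) (m₂ + 1) (m₃ + 1) × Fin 4 → G)
    (hflat : ∀ (x : FinTorusSite (m₀ + 1) (m₁ + 1) (m₂ + 1) (m₃ + 1)) (μ ν : Fin 4), μ < ν →
      tHooftTwistTensor (slabTwist zM 1) x μ ν * finTorusPlaquette U x μ ν = 1) :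
    ∃ (g : FinTorusSite (m₀ + 1) (m₁ + 1) (m₂ + 1) (m₃ + 1) → G) (c₂ c₃ : G),
      c₂ ∈ Subgroup.center G ∧ c₃ ∈ Subgroup.center G ∧ U = gaugeAct g (ladderConfig ![A, B, c₂, c₃]) := by
  have hw : ∀ μ ν, slabTwist zM (1 : G) μ ν ∈ Subgroup.center G := fun μ ν => by
    unfold slabTwist; split_ifs
    · exact hM
    · exact Subgroup.one_mem _
    · exact Subgroup.one_mem _
  obtain ⟨g₀, Γ, hΓ, rfl⟩ := exists_gaugeAct_ladderConfig_of_twistedFlat hw U hflat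
  obtain ⟨h2, h3, -⟩ := eater_slabTwist_central hcent hΓ
  have h01 := ((eats_slabTwist_iff zM 1 Γ).mp hΓ).1
  have hpair : Γ 1 * Γ 0 * (Γ 1)⁻¹ * (Γ 0)⁻¹ = zM := by
    have e : zM = (Γ 0 * Γ 1 * (Γ 0)⁻¹ * (Γ 1)⁻¹)⁻¹ := eq_inv_of_mul_eq_one_left h01
    rw [e]; group
  obtain ⟨h, hA, hB⟩ := hconj A B (Γ 0) (Γ 1) hAB hpair
  refine ⟨g₀ * fun _ => h, Γ 2, Γ 3, h2, h3, ?_⟩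
  rw [gaugeAct_mul, gaugeAct_const_ladderConfig]
  congr 1
  funext e
  congr 1
  funext μ
  fin_cases μ
  · simpa using hA
  · simpa using hB
  · simpa using (conj_eq_of_mem_center h2 h).symm
  · simpa using (conj_eq_of_mem_center h3 h).symm

/-- ★ **Centre labels are gauge invariants; the residual gauge freedom is the centraliser of the pair**: decorated ladders `(A, B, c₂, c₃)`,
`(A, B, c₂', c₃')` with central labels are gauge equivalent (by `g`, `g'`) only if the labels agree, and then `g = g'·h`, `h ∈ C(A, B)`. [folklore] -/
theorem ladder_pair_labels_unique {A B c₂ c₃ c₂' c₃' : G} (hc₂ : c₂ ∈ Subgroup.center G) (hc₃ : c₃ ∈ Subgroup.center G)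
    {g g' : FinTorusSite (m₀ + 1) (m₁ + 1) (m₂ + 1) (m₃ + 1) → G}
    (heq : gaugeAct g (ladderConfig ![A, B, c₂, c₃]) = gaugeAct g' (ladderConfig ![A, B, c₂', c₃'])) :
    c₂' = c₂ ∧ c₃' = c₃ ∧ ∃ h : G, (g = fun x => g' x * h) ∧ h * A * h⁻¹ = A ∧ h * B * h⁻¹ = B := by
  obtain ⟨h, hg, hΓ⟩ := (gaugeAct_ladderConfig_eq_gaugeAct_ladderConfig_iff g g' _ _).mp heq
  have e0 := hΓ 0; have e1 := hΓ 1; have e2 := hΓ 2; have e3 := hΓ 3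
  simp only [Matrix.cons_val_zero, Matrix.cons_val_one] at e0 e1
  simp only [Matrix.cons_val] at e2 e3
  exact ⟨by rw [e2, conj_eq_of_mem_center hc₂], by rw [e3, conj_eq_of_mem_center hc₃], h, hg, e0.symm, e1.symm⟩

/-- ★ **Stabiliser of a decorated ladder** = constant gauge maps valued in the simultaneous centraliser of the eating pair. [folklore] -/
theorem gaugeAct_ladder_pair_eq_self_iff {A B c₂ c₃ : G} (hc₂ : c₂ ∈ Subgroup.center G) (hc₃ : c₃ ∈ Subgroup.center G)
    (g : FinTorusSite (m₀ + 1) (m₁ + 1) (m₂ + 1) (m₃ + 1) → G) :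
    gaugeAct g (ladderConfig ![A, B, c₂, c₃]) = ladderConfig ![A, B, c₂, c₃] ↔
      ∃ h : G, (g = fun _ => h) ∧ h * A * h⁻¹ = A ∧ h * B * h⁻¹ = B := by
  rw [gaugeAct_ladderConfig_eq_self_iff]
  refine exists_congr fun h => and_congr_right fun _ => ?_
  constructor
  · intro hμ
    exact ⟨by simpa using hμ 0, by simpa using hμ 1⟩
  · rintro ⟨hA, hB⟩ μ
    fin_cases μ
    · simpa using hA
    · simpa using hB
    · simpa using conj_eq_of_mem_center hc₂ h
    · simpa using conj_eq_of_mem_center hc₃ h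

end Slab

/-! ## §3 `SU(N)` with a generating twist: the critical manifold of the e₂-projected slab weight -/

section SpecialUnitary

open Literature.MathematicalPhysics.QuantumLattice

variable {N : ℕ} [NeZero N] {m₀ m₁ m₂ m₃ : ℕ}

/-- A reference pair eating `ω^k·1` in the slab files' orientation `B A B⁻¹ A⁻¹ = ω^k·1` (lit-4 p653142). [cite: tHooft1979Flux, §3] -/
theorem exists_pair_eating_suCenter (k : ZMod N) :
    ∃ A B : Matrix.specialUnitaryGroup (Fin N) ℂ, B * A * B⁻¹ * A⁻¹ = (suCenter N k : Matrix.specialUnitaryGroup (Fin N) ℂ) := by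
  obtain ⟨A, B, h⟩ := exists_pair_commutator_eq_suCenter (N := N) k
  exact ⟨B, A, h⟩

/-- ★★ **`SU(N)`, GENERATING TWIST: THE CLASSICAL VACUA OF THE MAGNETICALLY TWISTED SLAB ARE THE `N²` DECORATED TWIST EATERS.**
`z = ω^k·1`, `k` a unit of `ℤ/N`, reference pair `B A B⁻¹ A⁻¹ = z`: every configuration of any box with all plaquettes of
`tHooftTwistTensor (slabTwist z 1)` trivial is a gauge transform of `ladder(A, B, ω^i·1, ω^j·1)` for some `i, j : ℤ/N` (pairs conjugate:
lit-4 `pair_conj_of_commutator_eq_suCenter`; isolation: `centralizer_central_of_suCenter`; `Z(SU(N)) = Z_N`: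
`mem_center_specialUnitaryGroup_iff`). [cite: Gonzalezarroyo1998, §4.2] -/
theorem exists_gaugeAct_ladder_pair_of_twistedFlat_slab_specialUnitary {k : ZMod N} (hk : IsUnit k)
    {A B : Matrix.specialUnitaryGroup (Fin N) ℂ} (hAB : B * A * B⁻¹ * A⁻¹ = (suCenter N k : Matrix.specialUnitaryGroup (Fin N) ℂ))
    (U : FinTorusSite (m₀ + 1) (m₁ + 1) (m₂ + 1) (m₃ + 1) × Fin 4 → Matrix.specialUnitaryGroup (Fin N) ℂ)
    (hflat : ∀ (x : FinTorusSite (m₀ + 1) (m₁ + 1) (m₂ + 1) (m₃ + 1)) (μ ν : Fin 4), μ < ν →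
      tHooftTwistTensor (slabTwist (suCenter N k : Matrix.specialUnitaryGroup (Fin N) ℂ) 1) x μ ν * finTorusPlaquette U x μ ν = 1) :
    ∃ (g : FinTorusSite (m₀ + 1) (m₁ + 1) (m₂ + 1) (m₃ + 1) → Matrix.specialUnitaryGroup (Fin N) ℂ) (i j : ZMod N),
      U = gaugeAct g (ladderConfig ![A, B, (suCenter N i : Matrix.specialUnitaryGroup (Fin N) ℂ),
        (suCenter N j : Matrix.specialUnitaryGroup (Fin N) ℂ)]) := by
  have hconj : ∀ A B A' B' : Matrix.specialUnitaryGroup (Fin N) ℂ,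
      B * A * B⁻¹ * A⁻¹ = (suCenter N k : Matrix.specialUnitaryGroup (Fin N) ℂ) →
      B' * A' * B'⁻¹ * A'⁻¹ = (suCenter N k : Matrix.specialUnitaryGroup (Fin N) ℂ) →
        ∃ h : Matrix.specialUnitaryGroup (Fin N) ℂ, A' = h * A * h⁻¹ ∧ B' = h * B * h⁻¹ := fun A B A' B' h h' => by
    obtain ⟨g, hB, hA⟩ := pair_conj_of_commutator_eq_suCenter hk h h'
    exact ⟨g, hA, hB⟩
  obtain ⟨g, c₂, c₃, hc₂, hc₃, hU⟩ := exists_gaugeAct_ladder_pair_of_twistedFlat_slab (suCenter N k).2 hconj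
    (fun A B M h1 h2 h3 => centralizer_central_of_suCenter hk A B M h1 h2 h3) hAB U hflat
  obtain ⟨i, hi⟩ := (mem_center_specialUnitaryGroup_iff c₂).mp hc₂
  obtain ⟨j, hj⟩ := (mem_center_specialUnitaryGroup_iff c₃).mp hc₃
  exact ⟨g, i, j, by rw [hU, hi, hj]⟩

/-- ★ **Centre labels are gauge invariants; residual gauge freedom `Z_N`** (`SU(N)`, generating twist): decorated ladders over the same
reference pair are gauge equivalent only if the labels coincide, and then the gauge maps differ by a CONSTANT in `⟨ω^k·1⟩ = Z_N` (lit-4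
`centralizer_pair_eq_zpowers_of_isUnit`, p659597). [cite: Gonzalezarroyo1998, §4.2] -/
theorem ladder_pair_labels_unique_specialUnitary {k : ZMod N} (hk : IsUnit k)
    {A B : Matrix.specialUnitaryGroup (Fin N) ℂ} (hAB : B * A * B⁻¹ * A⁻¹ = (suCenter N k : Matrix.specialUnitaryGroup (Fin N) ℂ))
    {i j i' j' : ZMod N} {g g' : FinTorusSite (m₀ + 1) (m₁ + 1) (m₂ + 1) (m₃ + 1) → Matrix.specialUnitaryGroup (Fin N) ℂ}
    (heq : gaugeAct g (ladderConfig ![A, B, (suCenter N i : Matrix.specialUnitaryGroup (Fin N) ℂ),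
        (suCenter N j : Matrix.specialUnitaryGroup (Fin N) ℂ)]) =
      gaugeAct g' (ladderConfig ![A, B, (suCenter N i' : Matrix.specialUnitaryGroup (Fin N) ℂ),
        (suCenter N j' : Matrix.specialUnitaryGroup (Fin N) ℂ)])) :
    (suCenter N i' : Matrix.specialUnitaryGroup (Fin N) ℂ) = suCenter N i ∧
      (suCenter N j' : Matrix.specialUnitaryGroup (Fin N) ℂ) = suCenter N j ∧
      ∃ c : Matrix.specialUnitaryGroup (Fin N) ℂ,
        c ∈ Subgroup.zpowers (suCenter N k : Matrix.specialUnitaryGroup (Fin N) ℂ) ∧ g = fun x => g' x * c := by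
  obtain ⟨h2, h3, c, hg, hA, hB⟩ := ladder_pair_labels_unique (suCenter N i).2 (suCenter N j).2 heq
  have hmem : c ∈ {g : Matrix.specialUnitaryGroup (Fin N) ℂ | g * B * g⁻¹ = B ∧ g * A * g⁻¹ = A} := ⟨hB, hA⟩
  rw [centralizer_pair_eq_zpowers_of_isUnit hk hAB] at hmem
  exact ⟨h2, h3, c, hmem, hg⟩

/-- ★ **Stabiliser of a decorated twist-eating ladder in `SU(N)` = the `N` constant gauge maps valued in `Z_N`**: each gauge orbit of
classical vacua is a copy of `𝒢 / Z_N` (`𝒢` = all site maps into `SU(N)`). [cite: Gonzalezarroyo1998, §4.2] -/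
theorem gaugeAct_ladder_pair_eq_self_iff_specialUnitary {k : ZMod N} (hk : IsUnit k)
    {A B : Matrix.specialUnitaryGroup (Fin N) ℂ} (hAB : B * A * B⁻¹ * A⁻¹ = (suCenter N k : Matrix.specialUnitaryGroup (Fin N) ℂ))
    (i j : ZMod N) (g : FinTorusSite (m₀ + 1) (m₁ + 1) (m₂ + 1) (m₃ + 1) → Matrix.specialUnitaryGroup (Fin N) ℂ) :
    gaugeAct g (ladderConfig ![A, B, (suCenter N i : Matrix.specialUnitaryGroup (Fin N) ℂ),
        (suCenter N j : Matrix.specialUnitaryGroup (Fin N) ℂ)]) =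
      ladderConfig ![A, B, (suCenter N i : Matrix.specialUnitaryGroup (Fin N) ℂ),
        (suCenter N j : Matrix.specialUnitaryGroup (Fin N) ℂ)] ↔
      ∃ c : Matrix.specialUnitaryGroup (Fin N) ℂ,
        c ∈ Subgroup.zpowers (suCenter N k : Matrix.specialUnitaryGroup (Fin N) ℂ) ∧ g = fun _ => c := by
  rw [gaugeAct_ladder_pair_eq_self_iff (suCenter N i).2 (suCenter N j).2]
  refine exists_congr fun c => ?_
  have hset : c ∈ Subgroup.zpowers (suCenter N k : Matrix.specialUnitaryGroup (Fin N) ℂ) ↔ c * A * c⁻¹ = A ∧ c * B * c⁻¹ = B := by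
    have e := Set.ext_iff.mp (centralizer_pair_eq_zpowers_of_isUnit hk hAB) c
    simp only [Set.mem_setOf_eq, SetLike.mem_coe] at e
    rw [← e]; exact and_comm
  rw [hset]
  tauto

end SpecialUnitary

/-! ## §4 The zero set of the twisted Wilson weight (the integrand of `wilsonFinTorusTensorTwistedPartition`) -/

section Weight

variable {m₀ m₁ m₂ m₃ : ℕ}

/-- **The tensor-twisted Wilson action is gauge invariant** (centre-valued tensor, any matrix representation). [folklore] -/
theorem twistedAction_gaugeAct {n₀ n₁ n₂ n₃ M : ℕ} (ρ : G →* Matrix (Fin M) (Fin M) ℂ) {w : Fin 4 → Fin 4 → G}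
    (hw : ∀ μ ν, w μ ν ∈ Subgroup.center G) (g : FinTorusSite n₀ n₁ n₂ n₃ → G) (U : FinTorusSite n₀ n₁ n₂ n₃ × Fin 4 → G) :
    (∑ x : FinTorusSite n₀ n₁ n₂ n₃, ∑ q : {q : Fin 4 × Fin 4 // q.1 < q.2},
        ((M : ℝ) - (ρ (tHooftTwistTensor w x q.1.1 q.1.2 * finTorusPlaquette (gaugeAct g U) x q.1.1 q.1.2)).trace.re)) =
      ∑ x : FinTorusSite n₀ n₁ n₂ n₃, ∑ q : {q : Fin 4 × Fin 4 // q.1 < q.2},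
        ((M : ℝ) - (ρ (tHooftTwistTensor w x q.1.1 q.1.2 * finTorusPlaquette U x q.1.1 q.1.2)).trace.re) := by
  simp only [trace_twist_mul_finTorusPlaquette_gaugeAct ρ hw]

/-- **A decorated twist-eating ladder is a classical vacuum of the magnetically twisted slab** (any `G`: `B A B⁻¹ A⁻¹ = zM` central,
`c₂, c₃` central). [folklore] -/
theorem ladder_pair_twistedFlat {zM A B c₂ c₃ : G} (hM : zM ∈ Subgroup.center G) (hAB : B * A * B⁻¹ * A⁻¹ = zM)
    (hc₂ : c₂ ∈ Subgroup.center G) (hc₃ : c₃ ∈ Subgroup.center G)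
    (x : FinTorusSite (m₀ + 1) (m₁ + 1) (m₂ + 1) (m₃ + 1)) {μ ν : Fin 4} (hμν : μ < ν) :
    tHooftTwistTensor (slabTwist zM 1) x μ ν * finTorusPlaquette (ladderConfig ![A, B, c₂, c₃]) x μ ν = 1 := by
  refine (ladderConfig_twistedFlat_iff (slabTwist zM 1) _).mpr ((eats_slabTwist_iff zM 1 _).mpr ?_) x μ ν hμν
  have h2 := fun h : G => Subgroup.mem_center_iff.mp hc₂ h
  have h3 := fun h : G => Subgroup.mem_center_iff.mp hc₃ h
  simp only [Matrix.cons_val_zero, Matrix.cons_val_one, Matrix.cons_val]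
  refine ⟨?_, by rw [h3 c₂]; group, by rw [h2 A]; group, by rw [h3 A]; group, by rw [h2 B]; group, by rw [h3 B]; group⟩
  have e : A * B * A⁻¹ * B⁻¹ = zM⁻¹ := by rw [← hAB]; group
  rw [e, Subgroup.mem_center_iff.mp (Subgroup.inv_mem _ hM) zM, inv_mul_cancel]

open Literature.MathematicalPhysics.QuantumLattice in
/-- ★★ **THE ZERO SET OF THE e₂-PROJECTED SLAB WEIGHT** (`SU(N)`, generating twist, faithful unitary `ρ`): on any box the tensor-twisted
Wilson action of the magnetic slab `slabTwist (ω^k·1) 1` (the exponent of the summands `z^{k′} = 1` of `projSlabZ`) vanishes EXACTLY on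
`⋃_{(i,j)} 𝒢 • ladder(A, B, ω^i·1, ω^j·1)` (orbits `≅ 𝒢/Z_N`, pairwise distinct); positive elsewhere (`twistedAction_nonneg`); the summands
`z^{k′} ≠ 1` have empty zero set (`no_twistedFlat_slab_specialUnitary`). [cite: Gonzalezarroyo1998, §4.2] -/
theorem twistedAction_eq_zero_iff_exists_gaugeAct_ladder_specialUnitary {N : ℕ} [NeZero N] {k : ZMod N} (hk : IsUnit k)
    {A B : Matrix.specialUnitaryGroup (Fin N) ℂ} (hAB : B * A * B⁻¹ * A⁻¹ = (suCenter N k : Matrix.specialUnitaryGroup (Fin N) ℂ))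
    {M : ℕ} {ρ : Matrix.specialUnitaryGroup (Fin N) ℂ →* Matrix (Fin M) (Fin M) ℂ}
    (hρu : ∀ g, ρ g ∈ Matrix.unitaryGroup (Fin M) ℂ) (hinj : Function.Injective ρ)
    (U : FinTorusSite (m₀ + 1) (m₁ + 1) (m₂ + 1) (m₃ + 1) × Fin 4 → Matrix.specialUnitaryGroup (Fin N) ℂ) :
    (∑ x : FinTorusSite (m₀ + 1) (m₁ + 1) (m₂ + 1) (m₃ + 1), ∑ q : {q : Fin 4 × Fin 4 // q.1 < q.2},
        ((M : ℝ) - (ρ (tHooftTwistTensor (slabTwist (suCenter N k : Matrix.specialUnitaryGroup (Fin N) ℂ) 1) x q.1.1 q.1.2 *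
          finTorusPlaquette U x q.1.1 q.1.2)).trace.re)) = 0 ↔
      ∃ (g : FinTorusSite (m₀ + 1) (m₁ + 1) (m₂ + 1) (m₃ + 1) → Matrix.specialUnitaryGroup (Fin N) ℂ) (i j : ZMod N),
        U = gaugeAct g (ladderConfig ![A, B, (suCenter N i : Matrix.specialUnitaryGroup (Fin N) ℂ),
          (suCenter N j : Matrix.specialUnitaryGroup (Fin N) ℂ)]) := by
  have hw : ∀ μ ν, slabTwist (suCenter N k : Matrix.specialUnitaryGroup (Fin N) ℂ) 1 μ ν ∈
      Subgroup.center (Matrix.specialUnitaryGroup (Fin N) ℂ) := fun μ ν => by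
    unfold slabTwist; split_ifs
    · exact (suCenter N k).2
    · exact Subgroup.one_mem _
    · exact Subgroup.one_mem _
  constructor
  · intro h0
    exact exists_gaugeAct_ladder_pair_of_twistedFlat_slab_specialUnitary hk hAB U
      (twistedFlat_of_twistedAction_eq_zero hρu hinj _ U h0)
  · rintro ⟨g, i, j, rfl⟩
    rw [twistedAction_gaugeAct ρ hw]
    exact twistedAction_eq_zero_of_flat _ _ fun x μ ν hμν =>
      ladder_pair_twistedFlat (suCenter N k).2 hAB (suCenter N i).2 (suCenter N j).2 x hμν

end Weight

end Summit.QuantumFields.YangMills.Cruxes.IRcof.TwistedSlab
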